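import Literature.NumberTheory.EllipticCurves.FunctionFieldEllipticL
import Literature.NumberTheory.EllipticCurves.LFunctionSmulProofs
import Literature.NumberTheory.DiophantineGeometry.LocalReductionHasMultiplicativeReductionAtProofs
import Literature.RingTheory.DiscreteValuationRing.AdicCompletionResidueField
import HarnessLib

/-!
# The local Euler factor at a place may be computed before or after completion

Sibling proof file of `Literature.NumberTheory.EllipticCurves.FunctionFieldEllipticL` (D-0014
append protocol; provefact pass on the named fact
`Literature.NumberTheory.EllipticCurves.FunctionField.localPolynomial_completion_eq`).

Let `F` be a field, `v` a place of `F` in the sense of `FunctionFieldPlaces` (a proper valuation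
subring `O_v ⊊ F` which is a DVR), `F_v = v.Completion` the `v`-adic completion and
`Ô_v = v.CompletionIntegers` its valuation ring. Mathlib's local polynomial
`WeierstrassCurve.localPolynomial R W` of a Weierstrass equation `W` over `K = Frac R`
(T. Browning 2026; Silverman, *AEC* §C.16: `1 - a T + q T²`, `1 - T`, `1 + T`, `1` according to
the reduction type, `a = q + 1 - #W̃(k)`) is computed on the *chosen* minimal model
`W.minimal R = (exists_isMinimal R W).choose • W`.

## Verdict on `localPolynomial_completion_eq` (mis-stated: the curve must be elliptic)

The fact is stated for *every* `W : WeierstrassCurve F`. For a singular equation (`Δ = 0`)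
Mathlib's `valuation_Δ_aux` is constantly `⊥`, so `IsMinimal R X ↔ IsIntegral R X`
(`isMinimal_of_isIntegral_of_Δ_eq_zero` below): *every* integral model is "minimal" and
`W.minimal R` is an arbitrary integral model, whose reduction type is not an invariant — the nodal
cubic `y² + xy = x³` is `O_v`-integral with `c₄ = 1` (multiplicative reduction, local polynomial
`1 ∓ T`), while its rescaling `y² + πxy = x³` (`π` a uniformiser) is `O_v`-integral with `c₄ = π⁴`
(additive reduction, local polynomial `1`); see
`exists_isMinimal_hasMultiplicativeReduction_hasAdditiveReduction`. The two sides of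
`localPolynomial_completion_eq W` are evaluated on two *independent* such choices (over `O_v` and
over `Ô_v`), so for singular `W` the equation is not decided by Lean's axioms and the universal
closure `∀ W` has no proof. The same caveat is recorded in the tree for the sibling invariance
statements `WeierstrassCurve.localPolynomial_smul`, `WeierstrassCurve.localPolynomial_map_ringEquiv`
(hypothesis `[IsElliptic]`) and in the module docstring of
`Literature.NumberTheory.DiophantineGeometry.LocalReduction`. The source (Tate, Sém. Bourbaki 306,
§1) defines `L(s)` for an abelian variety, i.e. for an *elliptic* curve (`Δ ≠ 0`); Silverman's
Chapter VII likewise assumes `E/K` elliptic.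

**Corrected statement** (restate, do not delete): `localPolynomial_completion_eq_of_isElliptic`
— the same equation under `[W.IsElliptic]`, as a *closed* `Prop` (field, curve and place bound in
the body; the old def is moreover a `Prop` family in the section variable `W`, which no closed
`_holds` theorem can discharge) — discharged by `localPolynomial_completion_eq_of_isElliptic_holds`;
the old `Prop` at every elliptic `W` is the theorem `localPolynomial_completion_eq_of_isElliptic'`.

## Proof (Silverman, *AEC* VII.1 Prop. 1.3(b), VII.2, VII.5 Prop. 5.1; §C.16)

Write `M₁ = W.minimal O_v = C₁ • W`, `M₂ = (W_{F_v}).minimal Ô_v = C₂ • W_{F_v}`.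
* `isMinimal_baseChange_completion`: `M₁ ⊗ F_v` is `Ô_v`-minimal — minimality over the complete
  DVR `Ô_v` is equivalent to minimality over the valuation ring of `v` in `F`
  (`WeierstrassCurve.isMinimalAt_iff_isMinimal_integer_holds`: `F` is dense in `F_v`, `Ô_v` is
  open and `ord_v` is locally constant), and that valuation ring is `O_v`.
* `M₂ = (C₂ (C₁)⁻¹) • (M₁ ⊗ F_v)` relates two `Ô_v`-minimal equations of an elliptic curve, so
  reduction type and number of points of the reduction agree (VII.1.3(b), VII.2, VII.5.1:
  `hasGoodReduction_iff_of_isMinimal_of_eq_smul`, `hasMultiplicativeReduction_iff_…`,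
  `hasSplitMultiplicativeReduction_iff_…`, `natCard_point_reduction_eq_of_isMinimal_of_eq_smul`).
* For `M₁` over `O_v` versus `M₁ ⊗ F_v` over `Ô_v` the data agree by transport along
  `O_v → Ô_v`: the valuation of `F_v` extends `v`
  (`valuation_maximalIdeal_adicCompletion_eq_one_iff`, `…_lt_one_iff`), the integral models
  correspond (`integralModel_baseChange_completion`), and the residue fields are identified by
  `IsDedekindDomain.HeightOneSpectrum.residueFieldEquiv`
  (`O_v/𝔪_v ≃ Ô_v/𝔪̂_v`, completion does not change the residue field), which transports the
  reduced curve, its number of points and the splitting of the node-tangent polynomial.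

## References

* J. Tate, *On the conjectures of Birch and Swinnerton-Dyer and a geometric analog*, Sém. Bourbaki
  306 (1966), §1. [Tate1966Bourbaki]
* J. H. Silverman, *The Arithmetic of Elliptic Curves*, GTM 106, 2nd ed. (2009): VII.1 Prop. 1.3(b)
  (PDF p. 165), VII.5 Definition and Prop. 5.1 (PDF p. 174), App. C §16 (PDF p. 390).
  [SilvermanAEC2009]
-/

noncomputable section

open scoped Classical Polynomial

open IsDedekindDomain IsLocalRing WeierstrassCurve

namespace Literature.NumberTheory.EllipticCurves.FunctionField

variable {F : Type} [Field F]

/-! ### Minimality is unchanged by completion -/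

section Minimal

/-- A Weierstrass equation over `F` that is minimal with respect to the valuation ring `O_v` of a
place `v` stays minimal over the valuation ring `Ô_v` of the completion `F_v`: both notions say
"integral, and no integral `F`- resp. `F_v`-isomorphic equation has smaller `ord_v Δ`"; a change
of variables over `F_v` making the equation integral is approximated by one over `F`
(`WeierstrassCurve.isMinimalAt_iff_isMinimal_integer_holds`), and the valuation ring of `v` in `F`
is `O_v`. Silverman, *AEC* VII.1 (definition of minimality, PDF p. 165; for number fields VIII.8).
[cite: SilvermanAEC2009, VII.1 Definition (PDF p. 165)] -/
theorem isMinimal_baseChange_completion (v : Place F) (X : WeierstrassCurve F)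
    [hX : X.IsMinimal v.1] : (X.baseChange v.Completion).IsMinimal v.CompletionIntegers := by
  have he : ∀ x : F, (RingEquiv.refl F) x ∈
      (algebraMap (v.spectrum.valuation F).integer F).range ↔ x ∈ (algebraMap v.1 F).range := by
    intro x
    rw [RingEquiv.refl_apply, ← valuation_le_one_iff_mem_range_integer,
      ← valuation_maximalIdeal_le_one_iff v.1]
  have h1 : X.IsMinimal (v.spectrum.valuation F).integer := by
    have := (isMinimal_map_iff (R := v.1) (R' := (v.spectrum.valuation F).integer)
      (RingEquiv.refl F) he X).mpr hX
    rwa [RingEquiv.coe_ringHom_refl, WeierstrassCurve.map_id] at this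
  exact (isMinimalAt_iff_isMinimal_integer_holds v.spectrum X).mpr h1

end Minimal

/-! ### Transport of the reduction data along `O_v → Ô_v` -/

section Transport

variable (v : Place F) (X : WeierstrassCurve F)

/-- `F → F_v` restricted to `O_v → Ô_v → F_v`: the two composite maps `O_v → F_v` agree.
[folklore] -/
theorem algebraMap_completion_comp :
    (algebraMap F v.Completion).comp (algebraMap v.1 F) =
      (algebraMap v.CompletionIntegers v.Completion).comp
        (algebraMap v.1 v.CompletionIntegers) := by
  rw [← IsScalarTower.algebraMap_eq, ← IsScalarTower.algebraMap_eq]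

/-- Good reduction of an `O_v`-minimal equation may be tested after completion: `v(Δ) = 0` for
the equation over `F` iff for its base change to `F_v` (the valuation of `F_v` extends `v`).
Silverman, *AEC* VII.5 Prop. 5.1(a). [cite: SilvermanAEC2009, VII.5 Prop. 5.1(a) (PDF p. 174)] -/
theorem hasGoodReduction_baseChange_completion_iff [X.IsMinimal v.1] :
    (X.baseChange v.Completion).HasGoodReduction v.CompletionIntegers ↔
      X.HasGoodReduction v.1 := by
  have hX' := isMinimal_baseChange_completion v X
  rw [hasGoodReduction_iff, hasGoodReduction_iff, and_iff_right hX',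
    and_iff_right ‹X.IsMinimal v.1›, WeierstrassCurve.baseChange, map_Δ,
    (isEquiv_valuation_maximalIdeal_valued v.spectrum).eq_one_iff_eq_one,
    valued_algebraMap_adicCompletion]

/-- Multiplicative reduction of an `O_v`-minimal equation may be tested after completion
(`v(Δ) > 0`, `v(c₄) = 0` read in `F` or in `F_v`). Silverman, *AEC* VII.5 Prop. 5.1(b).
[cite: SilvermanAEC2009, VII.5 Prop. 5.1(b) (PDF p. 174)] -/
theorem hasMultiplicativeReduction_baseChange_completion_iff [X.IsMinimal v.1] :
    (X.baseChange v.Completion).HasMultiplicativeReduction v.CompletionIntegers ↔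
      X.HasMultiplicativeReduction v.1 := by
  have hX' := isMinimal_baseChange_completion v X
  rw [hasMultiplicativeReduction_iff, hasMultiplicativeReduction_iff, and_iff_right hX',
    and_iff_right ‹X.IsMinimal v.1›, WeierstrassCurve.baseChange, map_Δ, map_c₄,
    (isEquiv_valuation_maximalIdeal_valued v.spectrum).lt_one_iff_lt_one,
    (isEquiv_valuation_maximalIdeal_valued v.spectrum).eq_one_iff_eq_one,
    valued_algebraMap_adicCompletion, valued_algebraMap_adicCompletion]

/-- The integral model over `Ô_v` of the base change of an `O_v`-integral equation is the image
under `O_v → Ô_v` of its integral model over `O_v` (integral models are unique, `Ô_v → F_v`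
being injective). [folklore] -/
theorem integralModel_baseChange_completion [X.IsIntegral v.1]
    [(X.baseChange v.Completion).IsIntegral v.CompletionIntegers] :
    (X.baseChange v.Completion).integralModel v.CompletionIntegers =
      (X.integralModel v.1).map (algebraMap v.1 v.CompletionIntegers) := by
  refine integralModel_eq_of_baseChange_eq _ _ ?_
  rw [WeierstrassCurve.baseChange, WeierstrassCurve.baseChange, map_map,
    ← algebraMap_completion_comp, ← map_map]
  exact congrArg (fun Y : WeierstrassCurve F ↦ Y.map (algebraMap F v.Completion))
    (baseChange_integralModel_eq v.1 X)

/-- The residue field of `Ô_v` is the residue field of `O_v` (completion does not change the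
residue field): `IsDedekindDomain.HeightOneSpectrum.residueFieldEquiv` for the Dedekind domain
`O_v` at its maximal ideal, as an isomorphism `κ(O_v) ≃+* κ(Ô_v)`. Serre, *Local Fields* II §1.
[folklore] -/
def residueFieldCompletionEquiv :
    ResidueField v.1 ≃+* ResidueField v.CompletionIntegers :=
  HeightOneSpectrum.residueFieldEquiv F v.spectrum

/-- `residueFieldCompletionEquiv` is induced by `O_v → Ô_v`: it maps the residue of `r` to the
residue of its image. [folklore] -/
theorem residueFieldCompletionEquiv_residue (r : v.1) :
    residueFieldCompletionEquiv v (residue v.1 r) =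
      residue v.CompletionIntegers (algebraMap v.1 v.CompletionIntegers r) :=
  HeightOneSpectrum.residueFieldEquiv_apply_mk F v.spectrum r

/-- The compatibility `residue ∘ (O_v → Ô_v) = residueFieldCompletionEquiv ∘ residue` as an
identity of ring homomorphisms. [folklore] -/
theorem residue_comp_algebraMap_completionIntegers :
    (residue v.CompletionIntegers).comp (algebraMap v.1 v.CompletionIntegers) =
      ((residueFieldCompletionEquiv v : ResidueField v.1 ≃+* ResidueField v.CompletionIntegers) :
          ResidueField v.1 →+* ResidueField v.CompletionIntegers).comp (residue v.1) :=
  RingHom.ext fun r ↦ (residueFieldCompletionEquiv_residue v r).symm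

/-- `#κ(Ô_v) = #κ(O_v)`. [folklore] -/
theorem natCard_residueField_completionIntegers :
    Nat.card (ResidueField v.CompletionIntegers) = Nat.card (ResidueField v.1) :=
  (Nat.card_congr (residueFieldCompletionEquiv v).toEquiv).symm

/-- The reduction over `Ô_v` of the base change of an `O_v`-minimal equation is the reduction
over `O_v`, mapped along `κ(O_v) ≃ κ(Ô_v)`. Silverman, *AEC* VII.2. [folklore] -/
theorem reduction_baseChange_completion [X.IsMinimal v.1] :
    haveI := isMinimal_baseChange_completion v X
    (X.baseChange v.Completion).reduction v.CompletionIntegers =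
      (X.reduction v.1).map ((residueFieldCompletionEquiv v :
        ResidueField v.1 ≃+* ResidueField v.CompletionIntegers) :
          ResidueField v.1 →+* ResidueField v.CompletionIntegers) := by
  haveI := isMinimal_baseChange_completion v X
  rw [reduction, reduction, integralModel_baseChange_completion, map_map,
    residue_comp_algebraMap_completionIntegers, ← map_map]

/-- The reductions over `O_v` and over `Ô_v` have the same number of rational points over the
(isomorphic) residue fields. Silverman, *AEC* VII.2. [folklore] -/
theorem natCard_point_reduction_baseChange_completion [X.IsMinimal v.1] :
    haveI := isMinimal_baseChange_completion v X
    Nat.card ((X.baseChange v.Completion).reduction v.CompletionIntegers).toAffine.Point =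
      Nat.card (X.reduction v.1).toAffine.Point := by
  rw [reduction_baseChange_completion, natCard_point_map_ringEquiv]

/-- The node-tangent polynomial `c₄ T² + a₁ c₄ T − (54 b₆ − 3 b₂ b₄ + a₂ c₄)` of Mathlib's
`HasSplitMultiplicativeReduction` commutes with ring homomorphisms (copy of
`WeierstrassCurve.nodalTangents_map` of `BSDRootNumberPrimesEquivProofs`, reproved here to keep
the imports light). [folklore] -/
private theorem nodalTangents_map' {S T : Type*} [CommRing S] [CommRing T]
    (W : WeierstrassCurve S) (f : S →+* T) :
    Polynomial.C (W.map f).c₄ * Polynomial.X ^ 2 +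
        Polynomial.C ((W.map f).a₁ * (W.map f).c₄) * Polynomial.X -
        Polynomial.C (54 * (W.map f).b₆ - 3 * (W.map f).b₂ * (W.map f).b₄ +
          (W.map f).a₂ * (W.map f).c₄) =
      (Polynomial.C W.c₄ * Polynomial.X ^ 2 + Polynomial.C (W.a₁ * W.c₄) * Polynomial.X -
        Polynomial.C (54 * W.b₆ - 3 * W.b₂ * W.b₄ + W.a₂ * W.c₄)).map f := by
  simp only [Polynomial.map_sub, Polynomial.map_add, Polynomial.map_mul, Polynomial.map_pow,
    Polynomial.map_C, Polynomial.map_X, map_c₄, map_a₁, map_a₂, map_b₂, map_b₄, map_b₆, map_mul,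
    map_sub, map_add, map_ofNat, Polynomial.map_ofNat]

/-- A polynomial over `κ(O_v)` splits iff its image over `κ(Ô_v) ≃ κ(O_v)` splits. [folklore] -/
theorem splits_map_residueFieldCompletionEquiv_iff (f : Polynomial (ResidueField v.1)) :
    (f.map ((residueFieldCompletionEquiv v :
        ResidueField v.1 ≃+* ResidueField v.CompletionIntegers) :
          ResidueField v.1 →+* ResidueField v.CompletionIntegers)).Splits ↔ f.Splits := by
  refine ⟨fun h ↦ ?_, fun h ↦ h.map _⟩
  have h' := h.map ((residueFieldCompletionEquiv v).symm :
    ResidueField v.CompletionIntegers →+* ResidueField v.1)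
  rwa [Polynomial.map_map, RingEquiv.symm_comp, Polynomial.map_id] at h'

/-- Split multiplicative reduction of an `O_v`-minimal equation may be tested after completion:
the integral models correspond under `O_v → Ô_v`, hence so do the node-tangent polynomials, and
their reductions correspond under `κ(O_v) ≃ κ(Ô_v)`, which preserves splitting.
Silverman, *AEC* VII.5 Definition (PDF p. 174).
[cite: SilvermanAEC2009, VII.5 Definition (PDF p. 174)] -/
theorem hasSplitMultiplicativeReduction_baseChange_completion_iff [X.IsMinimal v.1] :
    (X.baseChange v.Completion).HasSplitMultiplicativeReduction v.CompletionIntegers ↔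
      X.HasSplitMultiplicativeReduction v.1 := by
  haveI := isMinimal_baseChange_completion v X
  have hm := hasMultiplicativeReduction_baseChange_completion_iff v X
  have halg : (algebraMap v.CompletionIntegers (ResidueField v.CompletionIntegers)).comp
      (algebraMap v.1 v.CompletionIntegers) =
      ((residueFieldCompletionEquiv v : ResidueField v.1 ≃+* ResidueField v.CompletionIntegers) :
          ResidueField v.1 →+* ResidueField v.CompletionIntegers).comp
        (algebraMap v.1 (ResidueField v.1)) :=
    residue_comp_algebraMap_completionIntegers v
  rw [hasSplitMultiplicativeReduction_iff, hasSplitMultiplicativeReduction_iff]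
  constructor
  · rintro ⟨h₁, h₂⟩
    haveI : X.HasMultiplicativeReduction v.1 := hm.mp h₁
    refine ⟨inferInstance, ?_⟩
    rwa [integralModel_baseChange_completion, nodalTangents_map', Polynomial.map_map, halg,
      ← Polynomial.map_map, splits_map_residueFieldCompletionEquiv_iff] at h₂
  · rintro ⟨h₁, h₂⟩
    haveI : (X.baseChange v.Completion).HasMultiplicativeReduction v.CompletionIntegers :=
      hm.mpr h₁
    refine ⟨inferInstance, ?_⟩
    rwa [integralModel_baseChange_completion, nodalTangents_map', Polynomial.map_map, halg,
      ← Polynomial.map_map, splits_map_residueFieldCompletionEquiv_iff]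

end Transport

/-! ### The local polynomial before and after completion -/

section LocalPolynomial

variable (v : Place F) (W : WeierstrassCurve F)

/-- **The local Euler factor of an elliptic curve at a place `v` may be computed over the DVR
`O_v ⊆ F` or over the valuation ring `Ô_v` of the completion `F_v`.** The base change to `F_v` of
the chosen `O_v`-minimal model `M₁` of `W` is an `Ô_v`-minimal equation
(`isMinimal_baseChange_completion`) that is `F_v`-isomorphic to the chosen `Ô_v`-minimal model
`M₂` of `W ⊗ F_v`; for an elliptic curve the reduction type and the number of points of the
reduction do not depend on the minimal equation (Silverman, *AEC* VII.1 Prop. 1.3(b), VII.2,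
VII.5 Prop. 5.1), and for `M₁` they are the same over `O_v` and over `Ô_v` (the valuation extends,
the residue fields agree). Hence Mathlib's `localPolynomial` (Tate (1966), §1; Silverman App. C
§16, PDF p. 390; VII.1 Prop. 1.3(b), PDF p. 165; VII.5 Prop. 5.1, PDF p. 174) agrees.
[cite: SilvermanAEC2009, App. C §16 (PDF p. 390) with VII.1 Prop. 1.3(b) and VII.5 Prop. 5.1] -/
theorem localPolynomial_baseChange_completion [W.IsElliptic] :
    (W.baseChange v.Completion).localPolynomial v.CompletionIntegers = W.localPolynomial v.1 := by
  -- the two chosen minimal models and the base change of the first one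
  obtain ⟨C₁, hC₁⟩ : ∃ C : VariableChange F, W.minimal v.1 = C • W := ⟨_, rfl⟩
  obtain ⟨C₂, hC₂⟩ : ∃ C : VariableChange v.Completion,
      (W.baseChange v.Completion).minimal v.CompletionIntegers =
        C • W.baseChange v.Completion := ⟨_, rfl⟩
  haveI hmin : ((W.minimal v.1).baseChange v.Completion).IsMinimal v.CompletionIntegers :=
    isMinimal_baseChange_completion v _
  haveI : (W.minimal v.1).IsElliptic := isElliptic_minimal v.1 W
  have hΔ : ((W.minimal v.1).baseChange v.Completion).Δ ≠ 0 := by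
    rw [WeierstrassCurve.baseChange, map_Δ]
    exact (map_ne_zero _).mpr (W.minimal v.1).isUnit_Δ.ne_zero
  have hrel : (W.baseChange v.Completion).minimal v.CompletionIntegers =
      (C₂ * (C₁.map (algebraMap F v.Completion))⁻¹) •
        (W.minimal v.1).baseChange v.Completion := by
    rw [hC₂, hC₁, mul_smul]
    simp only [WeierstrassCurve.baseChange, ← map_variableChange, inv_smul_smul]
  -- the four data of the case list agree
  have hg : ((W.baseChange v.Completion).minimal v.CompletionIntegers).HasGoodReduction
      v.CompletionIntegers ↔ (W.minimal v.1).HasGoodReduction v.1 := by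
    rw [hasGoodReduction_iff_of_isMinimal_of_eq_smul _ hrel,
      hasGoodReduction_baseChange_completion_iff]
  have hm : ((W.baseChange v.Completion).minimal v.CompletionIntegers).HasMultiplicativeReduction
      v.CompletionIntegers ↔ (W.minimal v.1).HasMultiplicativeReduction v.1 := by
    rw [hasMultiplicativeReduction_iff_of_isMinimal_of_eq_smul _ hrel hΔ,
      hasMultiplicativeReduction_baseChange_completion_iff]
  have hs : ((W.baseChange v.Completion).minimal
      v.CompletionIntegers).HasSplitMultiplicativeReduction v.CompletionIntegers ↔
      (W.minimal v.1).HasSplitMultiplicativeReduction v.1 := by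
    rw [hasSplitMultiplicativeReduction_iff_of_isMinimal_of_eq_smul _ hrel hΔ,
      hasSplitMultiplicativeReduction_baseChange_completion_iff]
  have hcount : Nat.card (((W.baseChange v.Completion).minimal v.CompletionIntegers).reduction
      v.CompletionIntegers).toAffine.Point =
      Nat.card ((W.minimal v.1).reduction v.1).toAffine.Point := by
    rw [natCard_point_reduction_eq_of_isMinimal_of_eq_smul _ hrel hΔ,
      natCard_point_reduction_baseChange_completion]
  have hq := natCard_residueField_completionIntegers v
  unfold localPolynomial
  simp only [hg, hm, hs, hcount, hq]

end LocalPolynomial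

/-! ### The corrected named fact and its discharge -/

section Corrected

/-- **Corrected statement** of `localPolynomial_completion_eq` (same source: Tate, Sém. Bourbaki
306 (1966), §1, where the Euler factors of `L(A, s)` are attached to the places `v` of the global
field through the local fields `F_v`; Silverman, *AEC* VII.1–VII.5 and §C.16 for elliptic
curves): for every field `F`, every **elliptic** curve `W / F` (`Δ ≠ 0`) and every place `v` of
`F`, Mathlib's local polynomial of `W` computed with respect to the DVR `O_v ⊆ F` equals the one
of `W ⊗ F_v` computed with respect to `Ô_v` — minimal models, reduction types and the residue
field are unchanged under completion. *Discrepancies with the tree's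
`localPolynomial_completion_eq`:* (i) that `Prop` omits the hypothesis that `W` be elliptic; for
a singular equation (`Δ = 0`) Mathlib's `IsMinimal` is satisfied by every integral model,
`WeierstrassCurve.minimal` is an arbitrary choice whose reduction type is not determined
(`exists_isMinimal_hasMultiplicativeReduction_hasAdditiveReduction`), and the two sides of the
equation are two independent such choices, so its universal closure over all `W` cannot be
proved; (ii) it is a `Prop` *family* (the curve `W` is a section variable, elaborated type
`∀ {F} [Field F], WeierstrassCurve F → Prop`), not a closed statement. This def is closed (the
field, the curve and the place are bound in the body) and carries `[W.IsElliptic]`; otherwise the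
body is the same. Discharged by `localPolynomial_completion_eq_of_isElliptic_holds`; the old
`Prop` at an elliptic `W` is `localPolynomial_completion_eq_of_isElliptic'`.
[cite: Tate1966Bourbaki, §1] -/
def localPolynomial_completion_eq_of_isElliptic : Prop :=
  ∀ {K : Type} [Field K] (W : WeierstrassCurve K) [W.IsElliptic] (v : Place K),
    W.localPolynomial v.1 = (W.baseChange v.Completion).localPolynomial v.CompletionIntegers

/-- **Discharge** of `localPolynomial_completion_eq_of_isElliptic`
(`localPolynomial_baseChange_completion`). Silverman, *AEC* §C.16 with VII.1 Prop. 1.3(b) and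
VII.5 Prop. 5.1; Tate (1966), §1.
[cite: SilvermanAEC2009, App. C §16 (PDF p. 390) with VII.1 Prop. 1.3(b) (PDF p. 165)] -/
theorem localPolynomial_completion_eq_of_isElliptic_holds : localPolynomial_completion_eq_of_isElliptic :=
  fun W _ v ↦ (localPolynomial_baseChange_completion v W).symm

/-- The tree's (over-general) `Prop` family `localPolynomial_completion_eq W` holds for every
**elliptic** `W` — the instances at which the source states it. Dependents written against the
old name are served by this theorem. [cite: Tate1966Bourbaki, §1] -/
theorem localPolynomial_completion_eq_of_isElliptic' (W : WeierstrassCurve F) [W.IsElliptic] :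
    localPolynomial_completion_eq W :=
  fun v ↦ (localPolynomial_baseChange_completion v W).symm

end Corrected

/-! ### Why the elliptic hypothesis is needed: "minimal" models of a singular equation -/

section Singular

variable {R : Type*} [CommRing R] [IsDomain R] [IsDiscreteValuationRing R]
  {K : Type*} [Field K] [Algebra R K] [IsFractionRing R K]

/-- For a *singular* Weierstrass equation (`Δ = 0`) Mathlib's minimality predicate degenerates:
every integral model is minimal (the quantity `valuation_Δ_aux` that `IsMinimal` maximises is
constantly `0 = ⊥`). [folklore] -/
theorem isMinimal_of_isIntegral_of_Δ_eq_zero (X : WeierstrassCurve K) [hX : X.IsIntegral R]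
    (hΔ : X.Δ = 0) : X.IsMinimal R := by
  refine ⟨⟨by simpa using hX, fun C hC _ ↦ ?_⟩⟩
  haveI : (C • X).IsIntegral R := hC
  rw [← Subtype.coe_le_coe, valuation_Δ_aux_eq_of_isIntegral, variableChange_Δ, hΔ, mul_zero,
    map_zero]
  exact zero_le

/-- At every place `v` of any field `F` there are two `F`-isomorphic `O_v`-"minimal" (singular)
Weierstrass equations, one with multiplicative and one with additive reduction in the sense of
Mathlib's predicates: the nodal cubic `y² + xy = x³` (`Δ = 0`, `c₄ = 1`) and its rescaling
`y² + πxy = x³` by a uniformiser `π` (`c₄ = π⁴`). Hence the reduction type — and Mathlib's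
`localPolynomial`, computed on a *chosen* minimal model — is not determined for singular
equations, which is why `localPolynomial_completion_eq` had to be restated under `[IsElliptic]`.
[folklore] -/
theorem exists_isMinimal_hasMultiplicativeReduction_hasAdditiveReduction (v : Place F) :
    ∃ (X : WeierstrassCurve F) (C : VariableChange F), X.IsMinimal v.1 ∧ (C • X).IsMinimal v.1 ∧
      X.HasMultiplicativeReduction v.1 ∧ (C • X).HasAdditiveReduction v.1 := by
  obtain ⟨π, hπ⟩ := v.exists_adicVal_eq_exp_neg_one
  have hπ1 : v.adicVal π < 1 := by
    rw [hπ, ← WithZero.exp_zero, WithZero.exp_lt_exp]; norm_num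
  have hπ0 : π ≠ 0 := by
    rintro rfl
    rw [map_zero] at hπ
    exact WithZero.exp_ne_zero hπ.symm
  have hπO : π ∈ v.1 := (v.adicVal_le_one_iff π).mp hπ1.le
  set X : WeierstrassCurve F := ⟨1, 0, 0, 0, 0⟩ with hX
  set C : VariableChange F := ⟨(Units.mk0 π hπ0)⁻¹, 0, 0, 0⟩ with hC
  have hCX : C • X = ⟨π, 0, 0, 0, 0⟩ := by
    ext <;> simp [hC, hX, variableChange_a₁, variableChange_a₂, variableChange_a₃,
      variableChange_a₄, variableChange_a₆]
  have hXΔ : X.Δ = 0 := by simp [hX, Δ, b₂, b₄, b₆, b₈]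
  have hXc₄ : X.c₄ = 1 := by simp [hX, c₄, b₂, b₄]
  have hCXΔ : (C • X).Δ = 0 := by rw [variableChange_Δ, hXΔ, mul_zero]
  have hCXc₄ : (C • X).c₄ = π ^ 4 := by
    rw [variableChange_c₄, hXc₄, mul_one, hC]
    simp
  haveI hXi : X.IsIntegral v.1 :=
    isIntegral_of_exists_lift v.1 ⟨1, by simp [hX]⟩ ⟨0, by simp [hX]⟩ ⟨0, by simp [hX]⟩
      ⟨0, by simp [hX]⟩ ⟨0, by simp [hX]⟩
  haveI hCXi : (C • X).IsIntegral v.1 := by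
    rw [hCX]
    exact isIntegral_of_exists_lift v.1 ⟨⟨π, hπO⟩, rfl⟩ ⟨0, by simp⟩ ⟨0, by simp⟩ ⟨0, by simp⟩
      ⟨0, by simp⟩
  haveI hXm : X.IsMinimal v.1 := isMinimal_of_isIntegral_of_Δ_eq_zero X hXΔ
  haveI hCXm : (C • X).IsMinimal v.1 := isMinimal_of_isIntegral_of_Δ_eq_zero (C • X) hCXΔ
  refine ⟨X, C, hXm, hCXm, ⟨?_, ?_⟩, ⟨?_, ?_⟩⟩
  · rw [hXΔ, map_zero]; exact zero_lt_one
  · rw [hXc₄, map_one]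
  · rw [hCXΔ, map_zero]; exact zero_lt_one
  · rw [hCXc₄, map_pow]
    exact pow_lt_one₀ zero_le hπ1 four_ne_zero

end Singular

end Literature.NumberTheory.EllipticCurves.FunctionField

end
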